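import Summits.ABC.IUTFork.Joshi.LogVolumesHullsScalingRigidity
import Summits.ABC.IUTFork.Joshi.LogVolumesHullsLocalField
import Literature.IUT.LogVolume.RamificationInvariants

/-!
# (9.9.4) rigidity AT ONE GENUINE LOCAL FIELD: with E-t23's Vol-compatible §9.10.2 data on the SAME `L′_w` at every label
# and one Tate-parameter root, print's exponent law forces `ℓ* ≤ 1` — the located L2 line with its hypotheses DISCHARGED

Proof-only sequel of `Joshi/LogVolumesHullsScalingRigidity.lean` (p433446, abc-iut-E-t56) over abc-iut-E-t23's
`LogVol.localFieldVolumeDatum` (p432005) — abc-iut cell, block E, rung LADDER-ABC:A2.E; seat abc-iut-E-t56 ([J-III] lane-B reader).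
Source: K. Joshi, arXiv:2401.13508 **v4** (unrefereed; bib `Joshi2024ATS3`), (9.9.4) p.121 l.39–66 and Lemma 9.10.2.2 (2) p.123 l.24–38
of the render `HOME/lit/renders/Joshi-arxiv-2401.13508/`.

p433446 proved: label-independent norms of the roots ∧ `RootScaling scalingExponent` ⇒ `ℓ* ≤ 1`, with the label-independence
as a HYPOTHESIS (`hc`). Here that hypothesis is DISCHARGED for the intended §9.10 instantiation at a fixed place `w`: every label
`j` carries the SAME `p`-adic field `L′_w` with abc-iut-E-t23's Vol-compatible datum `localFieldVolumeDatum L′_w` (Haar measure,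
`Vol(𝒪) = 1`, absolute value = the MODULE `‖−‖^d` forced by Lemma 9.10.2.2 (2)) — for ANY choices of norm uniformizers `ϖ_j` and
exponents `d_j` satisfying E-t23's classical side condition `‖ϖ_j‖^{d_j} = q⁻¹` (they are then all equal: `degree_eq_of_hmod`, since two
norm uniformizers of one field have the same norm — the tree's `Literature.IUT.LogVolume.norm_eq_norm_of_isUniformizer`) — and the roots `q^{1/2ℓ}_{w;j}` are ONE element of `L′_w`
(print's «writing `q_w` in place of `q_{w;1}`», p.121 l.67). CONCLUSION (`lstar_le_one_of_rootScaling_localField`): (9.9.4) with print's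
exponent law is then satisfiable only for `ℓ* ≤ 1`; for `ℓ* ≥ 2` (print: `ℓ ≥ 5`) the label-dependence must come from elsewhere —
label-dependent ELEMENTS `q^{1/2ℓ}_{w;j}` (abc-iut-E-t23, STATUS 08:54:01Z; abc-iut-E-t22 `toLocusDatum_valuationScaling_of_logReading`
p435679 puts it there) or label-dependent absolute values `|−|_{L′_{w,j}}` read through the perfectoid residue fields `K_{y_j}` (Thm.
4.2.2.1 (4), slot T-07), which Lemma 9.10.2.2's single Haar normalisation on `L′_w` does not supply (and which, carried as label-dependent
weights, make the tuple recipe (9.10.3.1) ill-defined on the tensor packet: abc-iut-E-t23 p432636 `log_weightedVol_update_sub`). This is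
plan/E/E-LOCATION.md §L2's attach point with every hypothesis a kernel object; it locates, it adjudicates nothing. Classical mathematics;
0 definitions; no side taken on [IUTchIII] Cor. 3.12 or on any author; typed ≠ proved.
-/

noncomputable section

namespace Summit.ABC.IUTFork.Joshi.LogVol

open MeasureTheory Literature.IUT.LogVolume Literature.NumberTheory.GaloisRepresentations.Ultrametric

section Uniformizers

variable {K : Type*} [NontriviallyNormedField K]

/-- E-t23's side condition `‖ϖ‖^d = q⁻¹` DETERMINES the exponent `d`: for norm uniformizers `ϖ, ϖ'` of one field and exponents
`d, d'` with `‖ϖ‖^d = q⁻¹ = ‖ϖ'‖^{d'}`, one has `d = d'` (so `d = [K : ℚ_p]·(normalisation)` is not a free parameter). [folklore] -/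
theorem degree_eq_of_hmod {ϖ ϖ' : Kˣ} (h : IsUniformizer ϖ) (h' : IsUniformizer ϖ') {d d' : ℕ} {c : ℝ}
    (hd : ‖(ϖ : K)‖ ^ d = c) (hd' : ‖(ϖ' : K)‖ ^ d' = c) : d = d' := by
  rw [← norm_eq_norm_of_isUniformizer K h h'] at hd'
  exact pow_right_injective₀ (norm_units_pos ϖ) h.1.ne (hd.trans hd'.symm)

end Uniformizers

namespace ScalingDatum

variable {lstar : ℕ} {K : Type*} [NontriviallyNormedField K] [IsUltrametricDist K] [ProperSpace K] [MeasurableSpace K]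
  [BorelSpace K] {X : Type*} [MeasurableSpace X] (Dw : ScalingDatum lstar (fun _ : Fin lstar => K) X)

/-- At E-t23's Vol-compatible local-field data on ONE field `K = L′_w` at every label (any uniformizers `ϖ_j`, exponents `d_j` with
`‖ϖ_j‖^{d_j} = q⁻¹`), the §9.10.2 absolute value of a FIXED element is label-independent: `|x|_{L′_{w,j}} = ‖x‖^{d}` with one `d`.
[folklore] -/
theorem abs_const_of_localField (ϖ : Fin lstar → Kˣ) (hϖ : ∀ i, IsUniformizer (ϖ i)) (d : Fin lstar → ℕ)
    (hd : ∀ i, d i ≠ 0) (hmod : ∀ i, ‖(ϖ i : K)‖ ^ d i = ((residueCard K : ℝ))⁻¹)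
    (hD : ∀ i, Dw.D i = localFieldVolumeDatum K (hϖ i) (hd i) (hmod i)) (x : K) (i j : Fin lstar) :
    (Dw.D i).abs x = (Dw.D j).abs x := by
  rw [hD i, hD j]
  show ‖x‖ ^ d i = ‖x‖ ^ d j
  rw [degree_eq_of_hmod (hϖ i) (hϖ j) (hmod i) (hmod j)]

/-- **(9.9.4) RIGIDITY AT ONE GENUINE LOCAL FIELD** (numbers, no verdict): if every label carries the same `p`-adic field `L′_w` with
E-t23's Vol-compatible §9.10.2 datum (p432005) and the Tate-parameter roots `q^{1/2ℓ}_{w;j}` are one element `q ∈ L′_w`, then print's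
(9.9.4) with exponent law `(j/ℓ*)²` (`RootScaling scalingExponent`, p429684) forces `ℓ* ≤ 1`. [folklore] -/
theorem lstar_le_one_of_rootScaling_localField (ϖ : Fin lstar → Kˣ) (hϖ : ∀ i, IsUniformizer (ϖ i)) (d : Fin lstar → ℕ)
    (hd : ∀ i, d i ≠ 0) (hmod : ∀ i, ‖(ϖ i : K)‖ ^ d i = ((residueCard K : ℝ))⁻¹)
    (hD : ∀ i, Dw.D i = localFieldVolumeDatum K (hϖ i) (hd i) (hmod i)) (q : K) (hq : ∀ i, Dw.qrt i = q)
    (h : Dw.RootScaling (ATS3.LocusDatum.scalingExponent lstar)) : lstar ≤ 1 :=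
  Dw.lstar_le_one_of_rootScaling_of_abs_const h fun i j => by
    rw [hq i, hq j]; exact Dw.abs_const_of_localField ϖ hϖ d hd hmod hD q i j

/-- … packaged as an incompatibility for `ℓ* ≥ 2` (print: `ℓ ≥ 5`, so `ℓ* ≥ 2`): one local field with its Vol-compatible absolute
value at every label and one root CANNOT satisfy (9.9.4). [folklore] -/
theorem not_rootScaling_localField (hl : 2 ≤ lstar) (ϖ : Fin lstar → Kˣ) (hϖ : ∀ i, IsUniformizer (ϖ i))
    (d : Fin lstar → ℕ) (hd : ∀ i, d i ≠ 0) (hmod : ∀ i, ‖(ϖ i : K)‖ ^ d i = ((residueCard K : ℝ))⁻¹)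
    (hD : ∀ i, Dw.D i = localFieldVolumeDatum K (hϖ i) (hd i) (hmod i)) (q : K) (hq : ∀ i, Dw.qrt i = q) :
    ¬ Dw.RootScaling (ATS3.LocusDatum.scalingExponent lstar) := fun h =>
  absurd (Dw.lstar_le_one_of_rootScaling_localField ϖ hϖ d hd hmod hD q hq h) (by omega)

/-- With the (9.7.2.2) log-reading of the exhibited classes (abc-iut-E-t22 p434712 / abc-iut-E-t56 p435502: `NormLogBK` supplied for the
module), the same rigidity reads on the classes themselves: one field, one root, `RootScaling scalingExponent` ⇒ the exhibited norms
`|log_BK(ξ_{w,j})|` are label-independent and E-t4's `ValuationScaling` of the projection forces `ℓ* ≤ 1`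
(`ATS3.LocusDatum.lstar_le_one_of_valuationScaling_of_theta_const`). [folklore] -/
theorem lstar_le_one_of_valuationScaling_localField (ϖ : Fin lstar → Kˣ) (hϖ : ∀ i, IsUniformizer (ϖ i))
    (d : Fin lstar → ℕ) (hd : ∀ i, d i ≠ 0) (hmod : ∀ i, ‖(ϖ i : K)‖ ^ d i = ((residueCard K : ℝ))⁻¹)
    (hD : ∀ i, Dw.D i = localFieldVolumeDatum K (hϖ i) (hd i) (hmod i)) (q : K) (hq : ∀ i, Dw.qrt i = q)
    (h1 : Dw.NormLogBK) (h2 : Dw.RootScaling (ATS3.LocusDatum.scalingExponent lstar)) :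
    (∀ i j : Fin lstar, (Dw.D i).abs (Dw.τ i) = (Dw.D j).abs (Dw.τ j)) ∧ lstar ≤ 1 := by
  have hc : ∀ i j : Fin lstar, (Dw.D i).abs (Dw.τ i) = (Dw.D j).abs (Dw.τ j) := fun i j => by
    rw [h1 i, h1 j, hq i, hq j]; exact Dw.abs_const_of_localField ϖ hϖ d hd hmod hD q i j
  exact ⟨hc, Dw.lstar_le_one_of_inputs_of_norm_const h1 h2 hc⟩

end ScalingDatum

end Summit.ABC.IUTFork.Joshi.LogVol

end
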